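import Literature.NumberTheory.Automorphic.ShimuraCurveRibetTakahashiPairwiseDenominatorProofs
import Literature.NumberTheory.Automorphic.ShimuraParametrizationIsogenyProofs
import Literature.NumberTheory.Automorphic.BrandtSetupAdmissible
import Literature.NumberTheory.EllipticCurves.IsogenyConductorProofs
import Literature.NumberTheory.EllipticCurves.TakahashiDegreeFormulaProofs
import Literature.NumberTheory.Automorphic.BrandtEigenvectorNonEisenstein
import Literature.NumberTheory.Automorphic.DefiniteOrderUnitsCardDvd
import Literature.NumberTheory.Automorphic.EichlerSubidealCount
import Literature.NumberTheory.Automorphic.BrandtModuleWeightSymmProofs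
import Literature.NumberTheory.EllipticCurves.NonEisensteinPrimeOfSurjective
import Literature.NumberTheory.EllipticCurves.OpenImage
import HarnessLib

/-!
# Pasten's two-prime package: the Eisenstein input is algebra in Brandt coordinates, and
# Lemma 6.7 above `163` is Mazur's theorem

Topic `NumberTheory/Automorphic`; a proofs-only companion (theorems only: no definition, no named
fact, nothing restated; D-0026) of `ShimuraCurveRibetTakahashi.lean`, for its named fact
`Literature.NumberTheory.Automorphic.PastenShimura2024_pairwise_denominator` (H. Pasten, *Shimura
curves and the abc conjecture*, J. Number Theory 254 (2024) = arXiv:1705.09251, §6.9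
(EqSequentially) p. 25 at `d = 1`, with Lemmas 6.8, 6.14, 6.15), continuing
`ShimuraCurveRibetTakahashiPairwiseTakahashiProofs.lean`.

**The point.** That file proved the package from the tree's facts
`takahashi2001_thm_2_3_of_coprime` (`hT1`), `mazurKenku_exists_cyclic_isogeny` and three printed
theorems taken as hypotheses: `hT2` (Takahashi 2001, Thm. 2.3 on the Shimura-curve side),
`hEis` (Ribet 1990, Thm. 3.12: the component group `Φ_r(J₀(N))` at `r ∥ N` is Eisenstein, in the
form "`i_r ∣ ℓ + 1 − a_ℓ`" of Pasten's proof of Lemma 6.14, p. 23) and `h67` (Pasten's Lemma 6.7,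
uniform non-Eisenstein primes). Two of these are dispensable:

1. **`hEis` is algebra.** In the coordinates in which `hT1` is stated — the Brandt module
   `ℤ[Cls O]` of an Eichler order of level `M` in the definite quaternion algebra of discriminant
   `r`, Gross's pairing `⟨e_c, e_{c'}⟩ = w_c δ_{cc'}`, the character group `X_r(J₀(Mr)) ≅ ℤ[Cls O]⁰`
   (Ribet 1990 §3) — Takahashi's `i_r` generates the ideal `{⟨g_r, y⟩ : y ∈ ℤ[Cls O]⁰}` (Lemma 2.2;
   tree `Takahashi2001.exists_index_formula`), so `i_r ∣ w_c g_c − w_{c'} g_{c'}` for all classes.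
   The eigen-equation `T(ℓ) g = a_ℓ g`, Eichler's weight symmetry `w_c T_{cc'} = w_{c'} T_{c'c}`
   (tree `Brandt.XiSetup.weight_mul_matrix_symm`) and column sums `ℓ + 1` (tree
   `Brandt.XiSetup.sum_matrix_prime_eq`) give `(a_ℓ − ℓ − 1) · w_c g_c = Σ_{c'} T_{c'c}
   (w_{c'} g_{c'} − w_c g_c)` (the computation of the tree's mod-`p` criterion
   `Brandt.dvd_sub_of_forall_dvd_weight_mul_sub`, Gross 1987 §2), hence
   `i_r ∣ w_c g_c (a_ℓ − ℓ − 1)` for every `c`; since `g_r` is primitive (`Σ t_c g_c = 1`, tree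
   `Takahashi2001.exists_dual_apply_eq_one_of_eigenLattice_eq`) and `w_c ∣ 12` (tree
   `Brandt.XiSetup.weight_dvd_twelve`), **`i_r ∣ 12 (ℓ + 1 − a_ℓ)` for every prime `ℓ ∤ Mr`**
   (`Brandt.XiSetup.dvd_twelve_mul_sub_of_forall_dvd`, `exists_image_coker_eisenstein_of_brandtData`).
   The factor `12` (instead of Ribet's exact Eisenstein property, which needs the geometry of the
   degeneracy maps at the weights `w_c ∈ {2, 3, …}`) is harmless: it is absorbed in Pasten's `κ_S`.
2. **`h67` above `163` is Mazur + Chebotarev**, both in the tree: Pasten's Lemma 6.3 (p. 21: "As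
   `ℓ > 163`, from [Mazur] `A[ℓ]` is irreducible, and the claim follows from … Chebotarev") is the
   tree's named fact `Literature.NumberTheory.EllipticCurves.mazur_isogeny_irreducible` followed by
   the tree's THEOREM `exists_prime_not_dvd_lFunction_sub_of_hasIrreducibleModPGaloisRep`
   (Chebotarev for division fields, proved: `chebotarev_geomTorsion_holds`); and ONE good prime
   `r ∤ N_A` with `ℓ ∤ r + 1 − a_r(A)` is all that Lemma 6.14 consumes. Only the primes `ℓ ≤ 163`
   of Lemma 6.7 (Pasten's Lemmas 6.4–6.6: Faltings on the modular curves `Y_H`, Shafarevich) remain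
   a hypothesis (`h67small`, in the weak one-good-prime form; fed by the printed Lemma 6.7 verbatim
   in `…_of_lemma_6_7`).

So this file proves `PastenShimura2024_pairwise_denominator` from: the named facts
`mazur_isogeny_irreducible`, `mazurKenku_exists_cyclic_isogeny`, the Ogg–Saito schema (or Carayol)
for the level; the character-group dictionary at `D = 1` (`hDict`: the hypothesis package of the
tree's `takahashi2001_thm_2_3_of_brandtDictionary'` — its named facts
`takahashi2001_characterGroupDictionary` ∧ `takahashi2001_brandtEigenLattice_rank_one` — at a prime
`r ∥ N` instead of square-free `N`, and recording that the character group CONTAINS every vector of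
degree zero, `Σ_c v_c = 0`, i.e. is the degree-zero sublattice, as printed: Ribet 1990 Prop. 3.1); `hT2`
(unchanged); and `h67small`. The dictionary `hDict` also yields `hT1` itself
(`takahashi2001_thm_2_3_of_coprime_of_brandtDictionary`), so the inputs of the previous file are a
strict superset of these.

## Contents

* §A `Brandt.dvd_weight_mul_mul_sub_of_forall_dvd_sub`, `Brandt.dvd_mul_sub_of_forall_dvd_sub`,
  `Brandt.XiSetup.dvd_twelve_mul_sub_of_forall_dvd` — the integral Eisenstein criterion.
* §B `exists_image_coker_eisenstein_of_brandtData` — Takahashi's Thm. 2.3 AND `i ∣ 12(ℓ + 1 − a_ℓ)`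
  for one curve and one setup, from Brandt data; `imageCokernel_package_of_brandtDictionary`,
  `takahashi2001_thm_2_3_of_coprime_of_brandtDictionary`.
* §C `exists_dvd_of_eisenstein12_of_mazur` — Lemma 6.14 with the factor `12`, primes `> 163` from
  Mazur's theorem; `small_lemma_6_7_of_lemma_6_7` — the printed Lemma 6.7 feeds `h67small`.
* §D `PastenShimura2024_pairwise_denominator_of_imageCokernel_package` — the core of the previous
  file, parametrised by the image–cokernel package with a constant `K` and the Lemma 6.14 package.
* §E `PastenShimura2024_pairwise_denominator_of_brandtDictionary_of_level`, `…_of_oggSaito`,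
  `…_of_carayol`, `…_of_lemma_6_7_of_oggSaito`.

## References

* H. Pasten, J. Number Theory 254 (2024) = arXiv:1705.09251: Lemma 6.3 p. 21, Lemma 6.7/6.8 p. 22,
  Prop. 6.13 and Lemma 6.14 (statement and proof) p. 23, Lemma 6.15 p. 24, §6.9 p. 25 (held text,
  read). [PastenShimura2024]
* S. Takahashi, J. Number Theory 90 (2001) 74–88: Lemma 2.2, Thm. 2.3 (p. 79), p. 84. [Takahashi2001]
* K. A. Ribet, Invent. Math. 100 (1990): Prop. 3.1 (character group = degree-zero divisors on the
  supersingular points), Thm. 3.12. [Ribet1990]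
* B. H. Gross, Heights and the special values of L-series (1987), §1–2. [Gross1987]
* M. Eichler, LNM 320 (1973), Ch. II §6 (16)–(17). [Eichler1973]
* B. Mazur, Invent. Math. 44 (1978), Thm. 1. [Mazur1978]

## Mathlib / tree search

Reused (tree): `Brandt.sum_mul_weight_mul_eq_of_mulVec_eq_smul`, `Brandt.XiSetup.weight_mul_matrix_symm`,
`Brandt.XiSetup.sum_matrix_prime_eq`, `Brandt.XiSetup.weight_dvd_twelve`,
`Takahashi2001.exists_index_formula`, `Takahashi2001.exists_eq_span_of_finrank_eq_one`,
`Takahashi2001.exists_dual_apply_eq_one_of_eigenLattice_eq`, `xi_lFunction_eq_sum`,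
`exists_prime_not_dvd_lFunction_sub_of_hasIrreducibleModPGaloisRep`, `not_mem_mazurPrimes_of_lt`,
`dvd_prod_pow_of_factorization_le`, `one_le_prod_pow_and_primeFactors_lt`, and everything the core of
`…PairwiseTakahashiProofs` uses. Mathlib: `LinearMap.pi_apply_eq_sum_univ`, `Nat.factorization_mul`,
`Nat.factorization_le_iff_dvd`.
-/

noncomputable section

open scoped MatrixGroups ModularForm BigOperators Matrix

namespace Literature.NumberTheory.Automorphic

/-! ## §A. The integral Eisenstein criterion in the Brandt module -/

namespace Brandt

section Abstract

variable {ι : Type*} [Fintype ι]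

/-- **Integral Eisenstein criterion, one class.** Let `T` be a square integer matrix with constant
column sums `s` (`Σ_i T_ij = s`), self-adjoint for the weights `w` (`w_i T_ij = w_j T_ji`), and
`T v = λ v`. If an integer `d` divides all the differences `w_i v_i − w_j v_j`, then
`d ∣ w_{i₀} v_{i₀} (λ − s)` for every `i₀`: indeed `(λ − s) w_{i₀} v_{i₀} = Σ_i T_{i i₀}
(w_i v_i − w_{i₀} v_{i₀})` (weight symmetry makes `(w_i v_i)` a `Tᵀ`-eigenvector, and
`Tᵀ 𝟙 = s 𝟙`). The mod-`p` case is the tree's `Brandt.dvd_sub_of_forall_dvd_weight_mul_sub`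
(Gross 1987 §2). [cite: Gross1987, §2 (Eisenstein vector)] [cite: Eichler1973, Ch. II §6 (16)–(17)] -/
theorem dvd_weight_mul_mul_sub_of_forall_dvd_sub (T : Matrix ι ι ℤ) (w : ι → ℤ) {lam s : ℤ}
    {v : ι → ℤ} (hsymm : ∀ i j, w i * T i j = w j * T j i) (hcol : ∀ j, ∑ i, T i j = s)
    (hv : T *ᵥ v = lam • v) {d : ℤ} (hcong : ∀ i j, d ∣ w i * v i - w j * v j) (i₀ : ι) :
    d ∣ w i₀ * v i₀ * (lam - s) := by
  have heig := sum_mul_weight_mul_eq_of_mulVec_eq_smul T w hsymm hv i₀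
  have key : w i₀ * v i₀ * (lam - s) = ∑ i, T i i₀ * (w i * v i - w i₀ * v i₀) := by
    have h1 : ∑ i, T i i₀ * (w i * v i - w i₀ * v i₀) =
        ∑ i, T i i₀ * (w i * v i) - (∑ i, T i i₀) * (w i₀ * v i₀) := by
      rw [Finset.sum_mul, ← Finset.sum_sub_distrib]
      exact Finset.sum_congr rfl fun i _ => by ring
    rw [h1, heig, hcol i₀]
    ring
  rw [key]
  exact Finset.dvd_sum fun i _ => Dvd.dvd.mul_left (hcong i i₀) _

/-- **Integral Eisenstein criterion.** With `T`, `w`, `s`, `v`, `d` as in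
`dvd_weight_mul_mul_sub_of_forall_dvd_sub`, if moreover every weight divides `K` and `v` is
primitive in the strong sense `Σ_i t_i v_i = 1` for some integers `t_i` (a unimodular vector, e.g.
a generator of a saturated line), then **`d ∣ K (λ − s)`**: `K (λ − s) = Σ_i t_i (K/w_i) ·
w_i v_i (λ − s)`. For `d = i_r` (Takahashi's image order, which divides all `w_c g_c − w_{c'} g_{c'}`),
`s = ℓ + 1`, `K = 12` this is "`i_r ∣ 12 (a_ℓ − ℓ − 1)`", the integral form of "`Φ` is Eisenstein"
that Pasten's Lemma 6.14 consumes. [cite: Gross1987, §2 (Eisenstein vector)] [cite: PastenShimura2024, Lemma 6.14 p. 23 (proof)] -/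
theorem dvd_mul_sub_of_forall_dvd_sub (T : Matrix ι ι ℤ) (w : ι → ℤ) {lam s : ℤ}
    {v : ι → ℤ} (hsymm : ∀ i j, w i * T i j = w j * T j i) (hcol : ∀ j, ∑ i, T i j = s)
    (hv : T *ᵥ v = lam • v) {d : ℤ} (hcong : ∀ i j, d ∣ w i * v i - w j * v j)
    {K : ℤ} (hK : ∀ i, w i ∣ K) {t : ι → ℤ} (ht : ∑ i, t i * v i = 1) :
    d ∣ K * (lam - s) := by
  have hK' : ∀ i, ∃ k, K = w i * k := fun i => hK i
  choose k hk using hK'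
  have key : K * (lam - s) = ∑ i, t i * k i * (w i * v i * (lam - s)) := by
    calc K * (lam - s) = K * (lam - s) * ∑ i, t i * v i := by rw [ht, mul_one]
      _ = ∑ i, K * (lam - s) * (t i * v i) := by rw [Finset.mul_sum]
      _ = ∑ i, t i * k i * (w i * v i * (lam - s)) :=
          Finset.sum_congr rfl fun i _ => by rw [hk i]; ring
  rw [key]
  exact Finset.dvd_sum fun i _ =>
    Dvd.dvd.mul_left (dvd_weight_mul_mul_sub_of_forall_dvd_sub T w hsymm hcol hv hcong i) _

end Abstract

section Setup

variable {Nplus Nminus : ℕ}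

/-- **`d ∣ 12 (λ(ℓ) − ℓ − 1)` in a Brandt setup.** Let `S` be a Brandt setup of type `(N⁺, N⁻)`
(definite quaternion algebra of discriminant `N⁻`, Eichler order of level `N⁺`), `g ∈ L(λ)` a common
eigenvector of the Brandt matrices `T(ℓ)`, `ℓ ∤ N⁺N⁻`, which is unimodular in `ℤ^{Cls O}` (some
functional takes the value `1` on it — e.g. a generator of the eigen-line,
`Takahashi2001.exists_dual_apply_eq_one_of_eigenLattice_eq`), and `d` an integer dividing every
`w_c g_c − w_{c'} g_{c'}` (every Gross pairing `⟨g, e_c − e_{c'}⟩`). Then for every prime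
`ℓ ∤ N⁺N⁻`: `d ∣ 12 (λ(ℓ) − (ℓ + 1))` — by `dvd_mul_sub_of_forall_dvd_sub` with Eichler's weight
symmetry (`XiSetup.weight_mul_matrix_symm`), column sums `ℓ + 1` (`XiSetup.sum_matrix_prime_eq`) and
`w_c ∣ 12` (`XiSetup.weight_dvd_twelve`). For `g = g_r`, `d = i_r` this replaces Ribet's Eisenstein
theorem (Invent. Math. 100, Thm. 3.12) in Pasten's proof of Lemma 6.14, up to the factor `12`.
[cite: Ribet1990, §3 Thm. 3.12] [cite: PastenShimura2024, Lemma 6.14 p. 23 (proof)] -/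
theorem XiSetup.dvd_twelve_mul_sub_of_forall_dvd (S : XiSetup Nplus Nminus)
    [Fintype (ClassSet S.O)] {lam : ℕ → ℤ} {g : ClassSet S.O → ℤ}
    (hg : g ∈ eigenLattice (Nplus * Nminus) (matrix S.O) lam)
    (hunimod : ∃ φ : Module.Dual ℤ (ClassSet S.O → ℤ), φ g = 1)
    {d : ℤ} (hcong : ∀ c c', d ∣ (weight S.O c : ℤ) * g c - (weight S.O c' : ℤ) * g c')
    {ℓ : ℕ} (hℓ : ℓ.Prime) (hℓN : ¬ ℓ ∣ Nplus * Nminus) :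
    d ∣ 12 * (lam ℓ - (ℓ + 1)) := by
  classical
  obtain ⟨φ, hφ⟩ := hunimod
  -- `φ g = Σ_c φ(e_c) g_c = 1`
  have ht : ∑ c, φ (fun j => if c = j then (1 : ℤ) else 0) * g c = 1 := by
    have h := LinearMap.pi_apply_eq_sum_univ φ g
    rw [hφ] at h
    refine Eq.trans (Finset.sum_congr rfl fun c _ => ?_) h.symm
    rw [smul_eq_mul, mul_comm]
  have hK : ∀ c : ClassSet S.O, (weight S.O c : ℤ) ∣ (12 : ℤ) := fun c => by
    exact_mod_cast S.weight_dvd_twelve c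
  exact dvd_mul_sub_of_forall_dvd_sub (matrix S.O ℓ) (fun c => (weight S.O c : ℤ))
    (fun i j => S.weight_mul_matrix_symm ℓ i j) (fun j => S.sum_matrix_prime_eq hℓ hℓN j)
    (hg ℓ hℓ hℓN) hcong hK ht

end Setup

end Brandt

/-! ## §B. Takahashi's Thm. 2.3 together with `i_r ∣ 12 (ℓ + 1 − a_ℓ)`, from Brandt data -/

open Literature.NumberTheory.EllipticCurves (mazurKenku_exists_cyclic_isogeny
  mazur_isogeny_irreducible not_mem_mazurPrimes_of_lt takahashi2001_thm_2_3_of_coprime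
  exists_prime_not_dvd_lFunction_sub_of_hasIrreducibleModPGaloisRep xi_lFunction_eq_sum
  LFunction_eq_of_isIsogenous_holds conductorNorm_eq_of_isIsogenous_of_tate)
open Literature.NumberTheory.EllipticCurves.Takahashi2001 (exists_index_formula
  exists_eq_span_of_finrank_eq_one exists_dual_apply_eq_one_of_eigenLattice_eq)
open Literature.NumberTheory.EllipticCurves.ModularForms (ModularParametrizationData IsNewformOf
  PastenShimura2024_lemma_6_8_of_mazurKenku')

/-- **Takahashi 2001, Thm. 2.3, with the Eisenstein divisibility, for one curve and one setup, from
Brandt data.** As the tree's `Takahashi2001.exists_ij_of_brandtData'` (Takahashi §2 in the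
coordinates of p. 84: a sublattice `X ⊆ ℤ^{Cls O}` — the character group `X_r(J₀(Mr))` — maps
`pb = π^*`, `pf = π_*` adjoint for Gross's pairing and `u_E(a, b) = c_r a b`, `π_* π^* = δ`, `π_*`
onto, `X` saturated, the `a(W)`-eigen-lattice of rank one containing `π^* 1`), plus ONE more printed
property of the character group: it contains every vector of degree zero, `Σ_c v_c = 0`, in
particular the differences `e_c − e_{c'}` (Ribet 1990 Prop. 3.1: `X_r(J₀(Mr))` IS the group of
degree-zero divisors on `Cls O`). Conclusion: Takahashi's
`(i_r, j_r)` — `0 < i`, `i j = ord_r Δ_min(W)`, `i ∣ ξ`, `δ i = ξ j` — AND `i ∣ 12 (ℓ + 1 − a_ℓ(W))`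
for every prime `ℓ ∤ Mr`. Proof: `exists_index_formula` gives `i` as the generator of
`{u_J(g, y) : y ∈ X}`, so `i ∣ u_J(g, e_c − e_{c'}) = w_c g_c − w_{c'} g_{c'}`; then
`Brandt.XiSetup.dvd_twelve_mul_sub_of_forall_dvd` (the generator `g` of the eigen-line is unimodular).
No square-freeness of `M r` is used. [cite: Takahashi2001, Lemma 2.2 and Thm. 2.3 (p. 79), p. 84] [cite: Ribet1990, Prop. 3.1 and Thm. 3.12] [cite: PastenShimura2024, Lemma 6.14 p. 23 (proof)] -/
theorem exists_image_coker_eisenstein_of_brandtData (W : WeierstrassCurve ℚ) [W.IsElliptic]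
    (M r : ℕ) [NeZero (M * r)] (hr : r.Prime) (hN : W.conductorNorm ℤ = M * r)
    (P : ModularParametrizationData W (M * r)) (S : Brandt.XiSetup M r)
    [Fintype (Brandt.ClassSet S.O)] (X : Submodule ℤ (Brandt.ClassSet S.O → ℤ))
    (pb : ℤ →ₗ[ℤ] X) (pf : X →ₗ[ℤ] ℤ)
    (hadj : ∀ (a : ℤ) (y : X),
      ∑ i, (Brandt.weight S.O i : ℤ) * (pb a : Brandt.ClassSet S.O → ℤ) i *
          (y : Brandt.ClassSet S.O → ℤ) i =
        ((W.minimalDiscriminantNorm ℤ).factorization r : ℤ) * a * pf y)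
    (hδ : ∀ a : ℤ, pf (pb a) = (P.modularDegree : ℤ) * a) (hsurj : Function.Surjective pf)
    (hXsat : ∀ (m : ℤ) (v : Brandt.ClassSet S.O → ℤ), m ≠ 0 → m • v ∈ X → v ∈ X)
    (hX0 : ∀ v : Brandt.ClassSet S.O → ℤ, ∑ i, v i = 0 → v ∈ X)
    (hrank : Module.finrank ℤ
      (Brandt.eigenLattice (M * r) (Brandt.matrix S.O) (fun n => W.LFunction n)) = 1)
    (hmem : (pb 1 : Brandt.ClassSet S.O → ℤ) ∈
      Brandt.eigenLattice (M * r) (Brandt.matrix S.O) (fun n => W.LFunction n)) :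
    ∃ i j : ℕ, 0 < i ∧ i * j = (W.minimalDiscriminantNorm ℤ).factorization r ∧
      i ∣ S.xi (fun n => W.LFunction n) ∧
      P.modularDegree * i = S.xi (fun n => W.LFunction n) * j ∧
      ∀ ℓ : ℕ, ℓ.Prime → ¬ ℓ ∣ M * r → (i : ℤ) ∣ 12 * ((ℓ + 1 : ℤ) - W.LFunction ℓ) := by
  classical
  set c : ℕ := (W.minimalDiscriminantNorm ℤ).factorization r with hc_def
  set δ : ℕ := P.modularDegree with hδ_def
  -- the generator `g₀` of the eigen-line; `π^* 1 = j g₀`, `j ≠ 0`, `g₀ ∈ X`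
  obtain ⟨g₀, hg₀, hL⟩ := exists_eq_span_of_finrank_eq_one hrank
  have hg₀mem : g₀ ∈ Brandt.eigenLattice (M * r) (Brandt.matrix S.O) (fun n => W.LFunction n) := by
    rw [hL]; exact Submodule.mem_span_singleton_self g₀
  rw [hL] at hmem
  obtain ⟨j, hj⟩ := Submodule.mem_span_singleton.mp hmem
  have hδ0 : 0 < δ := P.deg_pos
  have hj0 : j ≠ 0 := by
    rintro rfl
    have h0 : pb 1 = 0 := Subtype.ext (by rw [← hj, zero_smul]; rfl)
    have h1 := hδ 1
    rw [h0, map_zero, mul_one] at h1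
    exact hδ0.ne' (by exact_mod_cast h1.symm)
  have hg₀X : g₀ ∈ X := hXsat j g₀ hj0 (by rw [hj]; exact (pb 1).2)
  obtain ⟨g, rfl⟩ : ∃ g : X, (g : Brandt.ClassSet S.O → ℤ) = g₀ := ⟨⟨g₀, hg₀X⟩, rfl⟩
  have hg : pb 1 = j • g := Subtype.ext (by rw [Submodule.coe_smul]; exact hj.symm)
  -- `c_r = ord_r Δ_min > 0`: `r ∣ N_E = M r ∣ Δ_min ≠ 0`
  have hc0 : 0 < c := by
    have hfin := WeierstrassCurve.finite_setOf_ordMinimalDiscriminant_ne_zero_holds (A := ℤ) W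
    have hdvd : W.conductorNorm ℤ ∣ W.minimalDiscriminantNorm ℤ :=
      W.conductorNorm_dvd_minimalDiscriminantNorm hfin
    have hpos : 0 < W.minimalDiscriminantNorm ℤ := W.minimalDiscriminantNorm_pos_holds
    have hrd : r ∣ W.minimalDiscriminantNorm ℤ :=
      dvd_trans ⟨M, by rw [hN, mul_comm]⟩ hdvd
    exact hr.factorization_pos_of_dvd hpos.ne' hrd
  -- Gross's pairing on `ℤ^{Cls O}` and its restriction `u_J` to `X`; `u_E(a, b) = c a b` on `ℤ`
  let B : (Brandt.ClassSet S.O → ℤ) →ₗ[ℤ] (Brandt.ClassSet S.O → ℤ) →ₗ[ℤ] ℤ :=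
    LinearMap.mk₂ ℤ (fun x y => ∑ i, (Brandt.weight S.O i : ℤ) * x i * y i)
      (fun x₁ x₂ y => by
        simp only [Pi.add_apply, mul_add, add_mul, Finset.sum_add_distrib])
      (fun a x y => by
        simp only [Pi.smul_apply, smul_eq_mul, Finset.mul_sum]
        exact Finset.sum_congr rfl fun i _ => by ring)
      (fun x y₁ y₂ => by
        simp only [Pi.add_apply, mul_add, Finset.sum_add_distrib])
      (fun a x y => by
        simp only [Pi.smul_apply, smul_eq_mul, Finset.mul_sum]
        exact Finset.sum_congr rfl fun i _ => by ring)
  have hB : ∀ x y : Brandt.ClassSet S.O → ℤ, B x y = ∑ i, (Brandt.weight S.O i : ℤ) * x i * y i :=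
    fun x y => rfl
  let uJ : X →ₗ[ℤ] X →ₗ[ℤ] ℤ := B.compl₁₂ X.subtype X.subtype
  have huJ : ∀ x y : X, uJ x y = ∑ i, (Brandt.weight S.O i : ℤ) * (x : Brandt.ClassSet S.O → ℤ) i *
      (y : Brandt.ClassSet S.O → ℤ) i := fun x y => by
    simp only [uJ, LinearMap.compl₁₂_apply, Submodule.coe_subtype, hB]
  let uE : ℤ →ₗ[ℤ] ℤ →ₗ[ℤ] ℤ :=
    LinearMap.mk₂ ℤ (fun a b => (c : ℤ) * a * b) (fun a₁ a₂ b => by ring)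
      (fun m a b => by simp only [smul_eq_mul]; ring) (fun a b₁ b₂ => by ring)
      (fun m a b => by simp only [smul_eq_mul]; ring)
  have huE : ∀ a b : ℤ, uE a b = (c : ℤ) * a * b := fun a b => rfl
  -- the hypotheses of the abstract theorem
  have hadj' : ∀ (a : ℤ) (y : X), uJ (pb a) y = uE a (pf y) := fun a y => by
    rw [huJ, huE, ← hadj a y]
  have hδ' : ∀ a : ℤ, pf (pb a) = (δ : ℤ) • a := fun a => by rw [hδ a, smul_eq_mul]
  have hgen : ∀ x : ℤ, ∃ m : ℤ, m • (1 : ℤ) = x := fun x => ⟨x, by rw [smul_eq_mul, mul_one]⟩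
  have hc' : 0 < uE 1 1 := by rw [huE, mul_one, mul_one]; exact_mod_cast hc0
  have hc'' : uE 1 1 = (c : ℤ) := by rw [huE, mul_one, mul_one]
  -- Lemma 2.2 / Thm. 2.3 with the ideal `(i) = {u_J(g, y)}` kept
  obtain ⟨i, hi, hI, hij, hih, hδi⟩ := exists_index_formula uJ uE pb pf hadj' hδ' hsurj hgen hc' hg
  -- `h_r = u_J(g, g) = S.xi`
  have hxi : S.xi (fun n => W.LFunction n) =
      ∑ i, Brandt.weight S.O i * ((g : Brandt.ClassSet S.O → ℤ) i).natAbs ^ 2 :=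
    xi_lFunction_eq_sum W S hg₀ hL
  have hh : uJ g g = (S.xi (fun n => W.LFunction n) : ℤ) := by
    rw [hxi, huJ, Nat.cast_sum]
    exact Finset.sum_congr rfl fun i _ => by push_cast; rw [sq_abs]; ring
  -- the Eisenstein divisibility: `i ∣ u_J(g, e_c − e_{c'}) = w_c g_c − w_{c'} g_{c'}`
  have hcong : ∀ c₁ c₂ : Brandt.ClassSet S.O,
      (i : ℤ) ∣ (Brandt.weight S.O c₁ : ℤ) * (g : Brandt.ClassSet S.O → ℤ) c₁ -
        (Brandt.weight S.O c₂ : ℤ) * (g : Brandt.ClassSet S.O → ℤ) c₂ := by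
    intro c₁ c₂
    set y : Brandt.ClassSet S.O → ℤ := Pi.single c₁ 1 - Pi.single c₂ 1 with hy_def
    have hysum : ∑ i, y i = 0 := by
      simp only [hy_def, Pi.sub_apply, Pi.single_apply, Finset.sum_sub_distrib, Finset.sum_ite_eq',
        Finset.mem_univ, if_true, sub_self]
    have hyX : y ∈ X := hX0 y hysum
    have hmemI : uJ g ⟨y, hyX⟩ ∈ LinearMap.range (uJ g) := LinearMap.mem_range_self _ _
    rw [hI, Ideal.mem_span_singleton] at hmemI
    have heq : uJ g ⟨y, hyX⟩ =
        (Brandt.weight S.O c₁ : ℤ) * (g : Brandt.ClassSet S.O → ℤ) c₁ -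
          (Brandt.weight S.O c₂ : ℤ) * (g : Brandt.ClassSet S.O → ℤ) c₂ := by
      rw [huJ]
      simp only [hy_def, Pi.sub_apply, Pi.single_apply, mul_sub, mul_ite, mul_one, mul_zero,
        Finset.sum_sub_distrib, Finset.sum_ite_eq', Finset.mem_univ, if_true]
    rwa [heq] at hmemI
  have heis : ∀ ℓ : ℕ, ℓ.Prime → ¬ ℓ ∣ M * r → (i : ℤ) ∣ 12 * ((ℓ + 1 : ℤ) - W.LFunction ℓ) := by
    intro ℓ hℓ hℓN
    have h := S.dvd_twelve_mul_sub_of_forall_dvd hg₀mem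
      (exists_dual_apply_eq_one_of_eigenLattice_eq hg₀ hL) hcong hℓ hℓN
    have e : (12 : ℤ) * ((ℓ + 1 : ℤ) - W.LFunction ℓ) = -(12 * (W.LFunction ℓ - (ℓ + 1))) := by ring
    rw [e]
    exact dvd_neg.mpr h
  refine ⟨i, j.natAbs, hi, ?_, ?_, ?_, heis⟩
  · have h1 : ((i * j.natAbs : ℕ) : ℤ) = (c : ℤ) := by
      rw [Nat.cast_mul, Int.natCast_natAbs, hij, hc'']
    exact_mod_cast h1
  · rw [hh] at hih
    exact_mod_cast hih
  · have h1 : ((δ * i : ℕ) : ℤ) = ((S.xi (fun n => W.LFunction n) * j.natAbs : ℕ) : ℤ) := by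
      rw [Nat.cast_mul, Nat.cast_mul, Int.natCast_natAbs, hδi, hh]
    exact_mod_cast h1

section Dictionary

variable
  /- (`hDict`) **The character-group dictionary at a prime `r ∥ N`, `D = 1`** — the hypothesis
  package `H` of the tree's `takahashi2001_thm_2_3_of_brandtDictionary'` (= its named facts
  `takahashi2001_characterGroupDictionary` ∧ `takahashi2001_brandtEigenLattice_rank_one`: Takahashi
  2001 §2 p. 78 and p. 84, Ribet 1990 §3, Buzzard 1997 Thm. 4.7, SGA 7 IX 11.5, multiplicity one),
  with two differences: (a) Takahashi's standing "`N` square-free" is replaced by what the proofs use,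
  `N = M r`, `gcd(M, r) = 1` (Takahashi p. 80; Pasten Prop. 6.13, remark), minimality of the datum
  being among the data of conductor-`M r` curves with the same newform, exactly as in the tree's
  `takahashi2001_thm_2_3_of_coprime`; (b) the sublattice `X` (the character group `X_r(J₀(Mr))`)
  contains every vector of degree zero (`Σ_c v_c = 0`; in particular the differences `e_c − e_{c'}`
  of classes) — Ribet 1990 Prop. 3.1 / Takahashi p. 84: it IS the lattice of degree-zero divisors on
  `Cls O`. -/
  (hDict : ∀ (W : WeierstrassCurve ℚ) [W.IsElliptic] (M r : ℕ) [NeZero (M * r)],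
    r.Prime → M.Coprime r → W.conductorNorm ℤ = M * r →
    ∀ P : ModularParametrizationData W (M * r),
      (∀ (W' : WeierstrassCurve ℚ) [W'.IsElliptic], W'.conductorNorm ℤ = M * r →
          ∀ P' : ModularParametrizationData W' (M * r),
          P'.f = P.f → P.modularDegree ≤ P'.modularDegree) →
      ∀ (S : Brandt.XiSetup M r) [Fintype (Brandt.ClassSet S.O)],
        ∃ (X : Submodule ℤ (Brandt.ClassSet S.O → ℤ)) (pb : ℤ →ₗ[ℤ] X) (pf : X →ₗ[ℤ] ℤ),
          (∀ (a : ℤ) (y : X),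
              ∑ i, (Brandt.weight S.O i : ℤ) * (pb a : Brandt.ClassSet S.O → ℤ) i *
                  (y : Brandt.ClassSet S.O → ℤ) i =
                ((W.minimalDiscriminantNorm ℤ).factorization r : ℤ) * a * pf y) ∧
          (∀ a : ℤ, pf (pb a) = (P.modularDegree : ℤ) * a) ∧
          Function.Surjective pf ∧
          (∀ (m : ℤ) (v : Brandt.ClassSet S.O → ℤ), m ≠ 0 → m • v ∈ X → v ∈ X) ∧
          (∀ v : Brandt.ClassSet S.O → ℤ, ∑ i, v i = 0 → v ∈ X) ∧
          Module.finrank ℤ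
              (Brandt.eigenLattice (M * r) (Brandt.matrix S.O) (fun n => W.LFunction n)) = 1 ∧
          (pb 1 : Brandt.ClassSet S.O → ℤ) ∈
            Brandt.eigenLattice (M * r) (Brandt.matrix S.O) (fun n => W.LFunction n))

include hDict in
/-- **The dictionary yields the tree's named fact `takahashi2001_thm_2_3_of_coprime`** (Takahashi
2001 Thm. 2.3 at `r ∥ N`, `D = 1`) — so the inputs of `…PairwiseTakahashiProofs` (which took that
fact as `hT1`) contain those of this file. [cite: Takahashi2001, Thm. 2.3 (p. 79), remark p. 80, p. 84] -/
theorem takahashi2001_thm_2_3_of_coprime_of_brandtDictionary : takahashi2001_thm_2_3_of_coprime := by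
  intro W _ M r _ hr hMr hN P hmin S
  classical
  letI : Fintype (Brandt.ClassSet S.O) := Fintype.ofFinite _
  obtain ⟨X, pb, pf, hadj, hδ, hsurj, hXsat, hX0, hrank, hmem⟩ := hDict W M r hr hMr hN P hmin S
  obtain ⟨i, j, hi, hij, hiξ, hδi, -⟩ := exists_image_coker_eisenstein_of_brandtData W M r hr hN P S
    X pb pf hadj hδ hsurj hXsat hX0 hrank hmem
  exact ⟨i, j, hi, hij, hiξ, hδi⟩

include hDict in
/-- **The image–cokernel package at `D = 1` with the Eisenstein divisibility (factor `12`)**, the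
`hIC` of `PastenShimura2024_pairwise_denominator_of_imageCokernel_package`, from the dictionary: at
a level `N = M r` (`r` prime, `gcd(M, r) = 1`) given as an equation, for a datum `P` of a curve of
conductor `N` of minimal degree among all data at level `N` with the same newform and every Brandt
setup `S` of type `(M, r)`: Takahashi's `(i_r, j_r)` with `δ i = ξ j`, `i j = c_r`, and
`i ∣ 12 (ℓ + 1 − a_ℓ)` for all primes `ℓ ∤ N`. [cite: Takahashi2001, Thm. 2.3 (p. 79)] [cite: PastenShimura2024, Lemma 6.14 p. 23 (proof)] -/
theorem imageCokernel_package_of_brandtDictionary {N : ℕ} [NeZero N] (W : WeierstrassCurve ℚ)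
    [W.IsElliptic] {M r : ℕ} (hNe : N = M * r) (hr : r.Prime) (hMr : M.Coprime r)
    (hW : W.conductorNorm ℤ = N) (P : ModularParametrizationData W N)
    (hmin : ∀ (W' : WeierstrassCurve ℚ) [W'.IsElliptic] (P' : ModularParametrizationData W' N),
      P'.f = P.f → P.modularDegree ≤ P'.modularDegree)
    (S : Brandt.XiSetup M r) :
    ∃ i j : ℕ, 0 < i ∧ i * j = (W.minimalDiscriminantNorm ℤ).factorization r ∧
      P.modularDegree * i = S.xi (fun n => W.LFunction n) * j ∧
      ∀ ℓ : ℕ, ℓ.Prime → ¬ ℓ ∣ N → (i : ℤ) ∣ ((12 : ℕ) : ℤ) * ((ℓ + 1 : ℤ) - W.LFunction ℓ) := by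
  subst hNe
  classical
  letI : Fintype (Brandt.ClassSet S.O) := Fintype.ofFinite _
  have hmin' : ∀ (W' : WeierstrassCurve ℚ) [W'.IsElliptic], W'.conductorNorm ℤ = M * r →
      ∀ P' : ModularParametrizationData W' (M * r), P'.f = P.f →
        P.modularDegree ≤ P'.modularDegree := fun W' _ _ P' hf => hmin W' P' hf
  obtain ⟨X, pb, pf, hadj, hδ, hsurj, hXsat, hX0, hrank, hmem⟩ := hDict W M r hr hMr hW P hmin' S
  obtain ⟨i, j, hi, hij, -, hδi, heis⟩ := exists_image_coker_eisenstein_of_brandtData W M r hr hW P S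
    X pb pf hadj hδ hsurj hXsat hX0 hrank hmem
  exact ⟨i, j, hi, hij, hδi, fun ℓ hℓ hℓN => by exact_mod_cast heis ℓ hℓ hℓN⟩

end Dictionary

/-! ## §C. Lemma 6.14 with the factor `12`: primes `> 163` from Mazur's theorem -/

/-- **Pasten 2024, Lemma 6.14 (pointwise, factor `12`), its large primes from Mazur's theorem.**
Hypotheses: Mazur's Theorem 1 (tree fact `mazur_isogeny_irreducible`: `E[ℓ]` irreducible for primes
`ℓ ∉ {2, …, 19, 37, 43, 67, 163}`), and Pasten's Lemma 6.7 for the primes `ℓ ≤ 163` only, in the weak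
form "one good prime": for each prime `ℓ ≤ 163` an exponent `β` such that every `A/ℚ` semistable
away from `S` has a prime `r ∤ N_A` with `ℓ^β ∤ r + 1 − a_r(A)`. Conclusion: one integer `κ₁ ≥ 1`
supported on primes `≤ 163` such that for every `A/ℚ` of conductor `N` squarefree away from `S` and
every `i ≥ 1` with `i ∣ 12 (r + 1 − a_r(A))` for all primes `r ∤ N`: `i ∣ κ₁`. Proof as printed
(p. 23) prime by prime: for `ℓ ≤ 163`, `v_ℓ(i) ≤ v_ℓ(12) + β − 1`; for `ℓ > 163`, Pasten's Lemma 6.3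
— `A[ℓ]` is irreducible (Mazur), so some good `r ∤ N_A` has `a_r(A) ≢ r + 1 (mod ℓ)` (Chebotarev,
tree theorem `exists_prime_not_dvd_lFunction_sub_of_hasIrreducibleModPGaloisRep`), whence `ℓ ∤ i`;
`κ₁ = 12 ∏_{ℓ ≤ 163} ℓ^{β_ℓ − 1}`. [cite: PastenShimura2024, Lemma 6.14 p. 23 (proof), Lemma 6.3 p. 21, Lemma 6.7 p. 22] [cite: Mazur1978, Thm. 1] -/
theorem exists_dvd_of_eisenstein12_of_mazur {S : Finset ℕ} (hMaz : mazur_isogeny_irreducible)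
    (h67small : ∀ ℓ : ℕ, ℓ.Prime → ℓ ≤ 163 → ∃ β : ℕ,
      ∀ (A : WeierstrassCurve ℚ) [A.IsElliptic],
        (∀ q : ℕ, q.Prime → q ∉ S → ¬ q ^ 2 ∣ A.conductorNorm ℤ) →
        ∃ r : ℕ, r.Prime ∧ ¬ r ∣ A.conductorNorm ℤ ∧
          ¬ ((ℓ ^ β : ℕ) : ℤ) ∣ (r + 1 : ℤ) - A.LFunction r) :
    ∃ κ₁ : ℕ, 1 ≤ κ₁ ∧ (∀ q ∈ κ₁.primeFactors, q ≤ 163) ∧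
      ∀ (A : WeierstrassCurve ℚ) [A.IsElliptic] {N : ℕ}, 0 < N → A.conductorNorm ℤ = N →
        (∀ q : ℕ, q.Prime → q ∉ S → ¬ q ^ 2 ∣ N) →
        ∀ {i : ℕ}, 0 < i →
          (∀ r : ℕ, r.Prime → ¬ r ∣ N → (i : ℤ) ∣ ((12 : ℕ) : ℤ) * ((r + 1 : ℤ) - A.LFunction r)) →
            i ∣ κ₁ := by
  classical
  choose β hβ using h67small
  let α : ℕ → ℕ := fun ℓ =>
    (12 : ℕ).factorization ℓ + (if h : ℓ.Prime ∧ ℓ ≤ 163 then β ℓ h.1 h.2 - 1 else 0)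
  have hα : ∀ ℓ, α ℓ =
      (12 : ℕ).factorization ℓ + (if h : ℓ.Prime ∧ ℓ ≤ 163 then β ℓ h.1 h.2 - 1 else 0) :=
    fun ℓ => rfl
  have h12fac : ∀ ℓ : ℕ, 13 ≤ ℓ → (12 : ℕ).factorization ℓ = 0 := fun ℓ h13 =>
    Nat.factorization_eq_zero_of_not_dvd fun h => by
      have := Nat.le_of_dvd (by norm_num) h
      omega
  have hα0 : ∀ ℓ : ℕ, ℓ.Prime → 164 ≤ ℓ → α ℓ = 0 := by
    intro ℓ hℓ h164
    rw [hα, h12fac ℓ (by omega), dif_neg (fun h => absurd h.2 (by omega)), add_zero]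
  refine ⟨∏ ℓ ∈ (Finset.range 164).filter Nat.Prime, ℓ ^ α ℓ,
    (one_le_prod_pow_and_primeFactors_lt 164 α).1,
    fun q hq => Nat.lt_succ_iff.mp ((one_le_prod_pow_and_primeFactors_lt 164 α).2 q hq), ?_⟩
  intro A _ N hN hAN hS i hi hEis
  refine dvd_prod_pow_of_factorization_le hi.ne' (fun ℓ hℓ => ?_) hα0
  have hℓZ : Prime (ℓ : ℤ) := Nat.prime_iff_prime_int.mp hℓ
  by_cases h163 : ℓ ≤ 163
  · -- small primes: `v_ℓ(i) ≤ v_ℓ(12) + β − 1` from one good prime `r`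
    obtain ⟨r, hr, hrN, hndvd⟩ := hβ ℓ hℓ h163 A (fun q hq hqS => by rw [hAN]; exact hS q hq hqS)
    have hrN' : ¬ r ∣ N := fun h => hrN (by rw [hAN]; exact h)
    have hdvd := hEis r hr hrN'
    set m : ℤ := (r + 1 : ℤ) - A.LFunction r with hm
    have hm0 : m ≠ 0 := fun h0 => hndvd (by rw [h0]; exact dvd_zero _)
    have hmabs : m.natAbs ≠ 0 := Int.natAbs_ne_zero.mpr hm0
    -- `i ∣ 12 |m|` in `ℕ`
    have hdvdN : i ∣ 12 * m.natAbs := by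
      have h1 : ((i : ℤ)).natAbs ∣ ((12 : ℤ) * m).natAbs :=
        Int.natAbs_dvd_natAbs.mpr (by exact_mod_cast hdvd)
      simpa [Int.natAbs_mul] using h1
    have h12 : (12 : ℕ) ≠ 0 := by norm_num
    have hfac : i.factorization ℓ ≤ (12 : ℕ).factorization ℓ + (m.natAbs).factorization ℓ := by
      have h := (Nat.factorization_le_iff_dvd hi.ne' (mul_ne_zero h12 hmabs)).mpr hdvdN ℓ
      rwa [Nat.factorization_mul h12 hmabs, Finsupp.add_apply] at h
    -- `v_ℓ(|m|) < β`
    have hlt : (m.natAbs).factorization ℓ < β ℓ hℓ h163 := by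
      by_contra hge
      push Not at hge
      apply hndvd
      have h1 : ℓ ^ β ℓ hℓ h163 ∣ m.natAbs :=
        (pow_dvd_pow ℓ hge).trans (Nat.ordProj_dvd _ ℓ)
      exact Int.natAbs_dvd_natAbs.mp (by simpa using h1)
    rw [hα, dif_pos ⟨hℓ, h163⟩]
    omega
  · -- large primes: `ℓ ∤ i` by Mazur + Chebotarev (Pasten's Lemma 6.3)
    push Not at h163
    haveI : Fact ℓ.Prime := ⟨hℓ⟩
    have hirr := hMaz A ℓ hℓ (not_mem_mazurPrimes_of_lt h163)
    obtain ⟨r, hr, -, hrN, hne⟩ :=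
      exists_prime_not_dvd_lFunction_sub_of_hasIrreducibleModPGaloisRep A ℓ hirr
    have hrN' : ¬ r ∣ N := fun h => hrN (by rw [hAN]; exact h)
    have hdvd := hEis r hr hrN'
    have hℓi : ¬ ℓ ∣ i := by
      intro hℓi
      have h1 : (ℓ : ℤ) ∣ ((12 : ℕ) : ℤ) * ((r + 1 : ℤ) - A.LFunction r) :=
        (Int.natCast_dvd_natCast.mpr hℓi).trans hdvd
      rcases hℓZ.dvd_or_dvd h1 with h2 | h2
      · have h3 : ℓ ∣ 12 := Int.natCast_dvd_natCast.mp h2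
        have := Nat.le_of_dvd (by norm_num) h3
        omega
      · apply hne
        have e : A.LFunction r - (r + 1 : ℤ) = -((r + 1 : ℤ) - A.LFunction r) := by ring
        rw [e]
        exact dvd_neg.mpr h2
    rw [Nat.factorization_eq_zero_of_not_dvd hℓi]
    exact Nat.zero_le _

/-- **The printed Lemma 6.7 feeds `h67small`.** Pasten's Lemma 6.7 (p. 22: for every prime `ℓ` an
integer `β_S(ℓ)`, `= 1` for `ℓ > 163`, such that every `A/ℚ` semi-stable away from `S` has infinitely
many primes `r` with `a_r(A) ≢ r + 1 mod ℓ^{β_S(ℓ)}`), in the verbatim rendering `h67` of the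
sibling files, implies the weak small-prime form used here (a prime `r > N_A` does not divide
`N_A ≥ 1`). [cite: PastenShimura2024, Lemma 6.7 p. 22] -/
theorem small_lemma_6_7_of_lemma_6_7 {S : Finset ℕ}
    (h67 : ∀ ℓ : ℕ, ℓ.Prime → ∃ β : ℕ, (163 < ℓ → β = 1) ∧
      ∀ (A : WeierstrassCurve ℚ) [A.IsElliptic],
        (∀ q : ℕ, q.Prime → q ∉ S → ¬ q ^ 2 ∣ A.conductorNorm ℤ) →
        ∀ r₀ : ℕ, ∃ r : ℕ, r₀ < r ∧ r.Prime ∧ ¬ ((ℓ ^ β : ℕ) : ℤ) ∣ (r + 1 : ℤ) - A.LFunction r)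
    (ℓ : ℕ) (hℓ : ℓ.Prime) (_hℓ163 : ℓ ≤ 163) :
    ∃ β : ℕ, ∀ (A : WeierstrassCurve ℚ) [A.IsElliptic],
      (∀ q : ℕ, q.Prime → q ∉ S → ¬ q ^ 2 ∣ A.conductorNorm ℤ) →
      ∃ r : ℕ, r.Prime ∧ ¬ r ∣ A.conductorNorm ℤ ∧
        ¬ ((ℓ ^ β : ℕ) : ℤ) ∣ (r + 1 : ℤ) - A.LFunction r := by
  obtain ⟨β, -, hβ⟩ := h67 ℓ hℓ
  refine ⟨β, fun A _ hS => ?_⟩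
  obtain ⟨r, hrN, hr, hndvd⟩ := hβ A hS (A.conductorNorm ℤ)
  exact ⟨r, hr, fun h => absurd hrN (not_lt.mpr (Nat.le_of_dvd A.conductorNorm_pos_holds h)), hndvd⟩

/-! ## §D. The core: the package from the image–cokernel package and the Lemma 6.14 package -/

section Core

variable
  /- (`hT2`) Takahashi 2001, Thm. 2.3 for `X₀^D(M)` at a prime `p ∣ D`, with Thm. 3.2 (a) — verbatim
  the `hT2` of `ShimuraCurveRibetTakahashiPairwiseTakahashiProofs.lean` (see there). -/
  (hT2 : ∀ {N D M p d : ℕ}, p.Prime → D = p * d → IsAdmissibleFactorization N D M →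
    ∀ (X : ShimuraCurveData D M) (W : WeierstrassCurve ℚ) [W.IsElliptic],
      W.conductorNorm ℤ = N →
    ∀ (W' : WeierstrassCurve ℚ) [W'.IsElliptic] (P : ShimuraParametrizationData X W'),
      P.IsMinimalFor W →
    ∀ S : Brandt.XiSetup (p * M) d,
      ∃ i j : ℕ, 0 < i ∧ i * j = (W'.minimalDiscriminantNorm ℤ).factorization p ∧
        i ∣ S.xi (fun n => W'.LFunction n) ∧
        P.deg * i = S.xi (fun n => W'.LFunction n) * j)

include hT2 in
/-- **Pasten 2024, the pairwise `gcd`-bounded denominator of `γ_{pq,M,E}` — the core of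
`PastenShimura2024_pairwise_denominator_of_takahashi_of_level`, parametrised.** Inputs: the tree's
fact `mazurKenku_exists_cyclic_isogeny` (Lemma 6.8); `hT2`; the level input `hlev`; and, for a fixed
natural number `K`, (`hIC`) the IMAGE–COKERNEL PACKAGE at `D = 1` — at every level `N = M r`
(`r` prime, `gcd(M, r) = 1`), for the optimal datum and every Brandt setup of type `(M, r)`,
Takahashi's `(i_r, j_r)` (`δ_{1,N} i = ξ j`, `i j = c_r(A_{1,N})`) together with the Eisenstein
divisibility `i ∣ K (ℓ + 1 − a_ℓ)` for the primes `ℓ ∤ N` — and (`h614`) the LEMMA 6.14 PACKAGE for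
the same `K`: for every finite `S` one `κ₁ ≥ 1` supported on primes `≤ 163` dividing out every such
`i`. With `K = 1` these are `exists_image_coker_of_eq_mul` / `exists_dvd_of_eisenstein_of_lemma_6_7`
of the previous file (Ribet's exact Eisenstein property); with `K = 12` they are supplied by §B–§C.
Proof: verbatim the printed assembly (Prop. 6.13 at `d = 1` as two instances of Thm. 2.3 with the
same `ξ`, Lemma 6.8 four times, Lemma 6.14 for `i_p(1,N)`, `i_q(1,N)`, Lemma 6.15 by switching, §6.9),
as in the previous file. [cite: PastenShimura2024, §6.9 (EqSequentially) p. 25 with d = 1, Prop. 6.13 and Lemma 6.14 p. 23, Lemma 6.15 p. 24, Lemma 6.8 p. 22] [cite: Takahashi2001, Thm. 2.3 (p. 79), Prop. 3.1 and Thm. 3.2 (a) (p. 82), p. 84] -/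
theorem PastenShimura2024_pairwise_denominator_of_imageCokernel_package (K : ℕ)
    (hMK : mazurKenku_exists_cyclic_isogeny)
    (hIC : ∀ {N : ℕ} [NeZero N] (W : WeierstrassCurve ℚ) [W.IsElliptic] {M r : ℕ},
      N = M * r → r.Prime → M.Coprime r → W.conductorNorm ℤ = N →
      ∀ P : ModularParametrizationData W N,
        (∀ (W' : WeierstrassCurve ℚ) [W'.IsElliptic] (P' : ModularParametrizationData W' N),
          P'.f = P.f → P.modularDegree ≤ P'.modularDegree) →
        ∀ S : Brandt.XiSetup M r,
          ∃ i j : ℕ, 0 < i ∧ i * j = (W.minimalDiscriminantNorm ℤ).factorization r ∧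
            P.modularDegree * i = S.xi (fun n => W.LFunction n) * j ∧
            ∀ ℓ : ℕ, ℓ.Prime → ¬ ℓ ∣ N → (i : ℤ) ∣ (K : ℤ) * ((ℓ + 1 : ℤ) - W.LFunction ℓ))
    (h614 : ∀ S : Finset ℕ, ∃ κ₁ : ℕ, 1 ≤ κ₁ ∧ (∀ q ∈ κ₁.primeFactors, q ≤ 163) ∧
      ∀ (A : WeierstrassCurve ℚ) [A.IsElliptic] {N : ℕ}, 0 < N → A.conductorNorm ℤ = N →
        (∀ q : ℕ, q.Prime → q ∉ S → ¬ q ^ 2 ∣ N) →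
        ∀ {i : ℕ}, 0 < i →
          (∀ r : ℕ, r.Prime → ¬ r ∣ N → (i : ℤ) ∣ (K : ℤ) * ((r + 1 : ℤ) - A.LFunction r)) →
            i ∣ κ₁)
    (hlev : ∀ {N : ℕ} [NeZero N] {W₁ : WeierstrassCurve ℚ} [W₁.IsElliptic]
      (D₁ : ModularParametrizationData W₁ N) (W : WeierstrassCurve ℚ) [W.IsElliptic],
      IsNewformOf W D₁.f → W.conductorNorm ℤ = N → W₁.conductorNorm ℤ = N) :
    PastenShimura2024_pairwise_denominator := by
  intro S
  obtain ⟨κ₁, hκ₁, hκ₁', h614⟩ := h614 S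
  -- the constant `κ' = ∏_{ℓ ≤ 163} ℓ^{α_{S,1}(ℓ)}` of Lemma 6.15, `α = v_ℓ(κ_S) + 3 log_ℓ 163`,
  -- and `κ = 163² κ_S² κ'²`
  set α : ℕ → ℕ := fun ℓ => κ₁.factorization ℓ + 3 * Nat.log ℓ 163 with hαdef
  have hα0 : ∀ ℓ : ℕ, ℓ.Prime → 164 ≤ ℓ → α ℓ = 0 := by
    intro ℓ hℓ h164
    have h1 : κ₁.factorization ℓ = 0 := by
      apply Finsupp.notMem_support_iff.mp
      rw [Nat.support_factorization]
      exact fun hmem => absurd (hκ₁' ℓ hmem) (by omega)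
    have h2 : Nat.log ℓ 163 = 0 := Nat.log_of_lt (by omega)
    show κ₁.factorization ℓ + 3 * Nat.log ℓ 163 = 0
    rw [h1, h2]
  set K' := ∏ ℓ ∈ (Finset.range 164).filter Nat.Prime, ℓ ^ α ℓ with hK'
  have hK1 : 1 ≤ K' := (one_le_prod_pow_and_primeFactors_lt 164 α).1
  refine ⟨163 ^ 2 * κ₁ ^ 2 * K' ^ 2, Nat.one_le_iff_ne_zero.mpr (mul_ne_zero (mul_ne_zero
    (pow_ne_zero 2 (by norm_num)) (pow_ne_zero 2 (by omega))) (pow_ne_zero 2 (by omega))), ?_⟩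
  intro N M p q _ hp hq hpq hadm X W _ _ hWN hS W₁ _ D₁ hf hmin W' _ P hPm
  -- `p, q ∥ N`, so `c_p(E), c_q(E) ≥ 1`
  have hpD : p ∣ p * q := Dvd.intro q rfl
  have hqD : q ∣ p * q := Dvd.intro_left p rfl
  obtain ⟨hpN, hp2N⟩ := hadm.dvd_and_not_sq_dvd hp hpD
  obtain ⟨hqN, hq2N⟩ := hadm.dvd_and_not_sq_dvd hq hqD
  have hpN' : p ∣ W.conductorNorm ℤ := hWN ▸ hpN
  have hp2N' : ¬ p ^ 2 ∣ W.conductorNorm ℤ := hWN ▸ hp2N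
  have hqN' : q ∣ W.conductorNorm ℤ := hWN ▸ hqN
  have hq2N' : ¬ q ^ 2 ∣ W.conductorNorm ℤ := hWN ▸ hq2N
  have hcpE := factorization_minimalDiscriminantNorm_pos_of_dvd W hp hpN'
  have hcqE := factorization_minimalDiscriminantNorm_pos_of_dvd W hq hqN'
  -- the two ways of writing the level, `N = (pM) q = (qM) p`, and the coprimality conditions
  have hMpos : 0 < M := Nat.pos_of_ne_zero fun hM0 => by
    have h := hadm.mul_eq
    rw [hM0, mul_zero] at h
    exact absurd h hadm.pos.ne
  have hNq : N = p * M * q := by rw [← hadm.mul_eq]; ring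
  have hNp : N = q * M * p := by rw [← hadm.mul_eq]; ring
  have hqM : Nat.Coprime q M := Nat.Coprime.coprime_dvd_left hqD hadm.coprime
  have hpM : Nat.Coprime p M := Nat.Coprime.coprime_dvd_left hpD hadm.coprime
  have hpq' : Nat.Coprime p q := (Nat.coprime_primes hp hq).mpr hpq
  have hcop_q : Nat.Coprime (p * M) q := Nat.coprime_mul_iff_left.mpr ⟨hpq', hqM.symm⟩
  have hcop_p : Nat.Coprime (q * M) p := Nat.coprime_mul_iff_left.mpr ⟨hpq'.symm, hpM.symm⟩
  -- Brandt setups of types `(pM, q)` and `(qM, p)` exist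
  have hodd : ∀ {r : ℕ}, r.Prime → Odd r.primeFactors.card := fun hr => by
    rw [Nat.Prime.primeFactors hr, Finset.card_singleton]; exact odd_one
  obtain ⟨Sq⟩ : Nonempty (Brandt.XiSetup (p * M) q) := Brandt.nonempty_xiSetup_iff_admissible.mpr
    ⟨Nat.mul_pos hp.pos hMpos, hq.prime.squarefree, hodd hq, hcop_q⟩
  obtain ⟨Sp⟩ : Nonempty (Brandt.XiSetup (q * M) p) := Brandt.nonempty_xiSetup_iff_admissible.mpr
    ⟨Nat.mul_pos hq.pos hMpos, hp.prime.squarefree, hodd hp, hcop_p⟩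
  -- `W₁ ∼ W ∼ W'` (Faltings; `IsMinimalFor`): equal `a_n`; conductor `N_{W₁} = N`
  have hiso₁ : W₁.IsIsogenous W :=
    isIsogenous_of_lFunction_prime_eq_of_not_dvd (N₀ := 1) one_ne_zero fun ℓ _ _ => by
      have h := (D₁.isNewformOf.2 ℓ).symm.trans (hf.2 ℓ)
      exact_mod_cast h
  have hiso₁' : W.IsIsogenous W₁ := hiso₁.symm_of_charZero
  have hW₁N : W₁.conductorNorm ℤ = N := hlev D₁ W hf hWN
  have hL₁ : W₁.LFunction = W.LFunction := LFunction_eq_of_isIsogenous_holds W₁ W hiso₁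
  have hL' : W'.LFunction = W.LFunction := (LFunction_eq_of_isIsogenous_holds W W' hPm.1).symm
  -- Thm. 2.3 at `D = 1` for `q ∥ N` and `p ∥ N` (with the Eisenstein divisibility), on `D₁`
  obtain ⟨iq, jq, hiq, hijq, eq1, heisq⟩ := hIC W₁ hNq hq hcop_q hW₁N D₁ hmin Sq
  obtain ⟨ip, jp, hip, hijp, ep1, heisp⟩ := hIC W₁ hNp hp hcop_p hW₁N D₁ hmin Sp
  -- Thm. 2.3 for `X₀^{pq}(M)` at `p` and at `q`, on `P`
  obtain ⟨ip', jp', hip', hijp', -, ep2⟩ := hT2 hp rfl hadm X W hWN W' P hPm Sq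
  obtain ⟨iq', jq', hiq', hijq', -, eq2⟩ := hT2 hq (mul_comm p q) hadm X W hWN W' P hPm Sp
  simp only [hL₁] at eq1 ep1 heisq heisp
  simp only [hL'] at ep2 eq2
  -- abbreviations
  set δ₁ := D₁.modularDegree
  set δ := P.deg
  set ξq := Sq.xi (fun n => W.LFunction n)
  set ξp := Sp.xi (fun n => W.LFunction n)
  set cp := (W.minimalDiscriminantNorm ℤ).factorization p
  set cq := (W.minimalDiscriminantNorm ℤ).factorization q
  set c₁p := (W₁.minimalDiscriminantNorm ℤ).factorization p
  set c₁q := (W₁.minimalDiscriminantNorm ℤ).factorization q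
  set c'p := (W'.minimalDiscriminantNorm ℤ).factorization p
  set c'q := (W'.minimalDiscriminantNorm ℤ).factorization q
  have hδ₁ : 0 < δ₁ := D₁.deg_pos
  have hδ : 0 < δ := P.deg_pos
  have hjq' : 0 < jq' := Nat.pos_of_ne_zero fun h0 => by
    rw [h0, mul_zero] at eq2; exact absurd eq2 (Nat.mul_pos hδ hiq').ne'
  have hjp' : 0 < jp' := Nat.pos_of_ne_zero fun h0 => by
    rw [h0, mul_zero] at ep2; exact absurd ep2 (Nat.mul_pos hδ hip').ne'
  -- Prop. 6.13 at `d = 1`, both lines (Thm. 2.3 twice with the same `ξ`; Thm. 3.2 (a))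
  have e613a : δ₁ * (ip ^ 2 * jq' ^ 2) = δ * (c₁p * c'q) := by
    calc δ₁ * (ip ^ 2 * jq' ^ 2) = (δ₁ * ip) * ip * jq' ^ 2 := by ring
      _ = ξp * jp * ip * jq' ^ 2 := by rw [ep1]
      _ = (ξp * jq') * (ip * jp) * jq' := by ring
      _ = (δ * iq') * c₁p * jq' := by rw [← eq2, hijp]
      _ = δ * (c₁p * (iq' * jq')) := by ring
      _ = δ * (c₁p * c'q) := by rw [hijq']
  have e613b : δ₁ * (iq ^ 2 * jp' ^ 2) = δ * (c₁q * c'p) := by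
    calc δ₁ * (iq ^ 2 * jp' ^ 2) = (δ₁ * iq) * iq * jp' ^ 2 := by ring
      _ = ξq * jq * iq * jp' ^ 2 := by rw [eq1]
      _ = (ξq * jp') * (iq * jq) * jp' := by ring
      _ = (δ * ip') * c₁q * jp' := by rw [← ep2, hijq]
      _ = δ * (c₁q * (ip' * jp')) := by ring
      _ = δ * (c₁q * c'p) := by rw [hijp']
  -- Lemma 6.8 (Mazur–Kenku) for `A_{1,N}` and `A_{pq,M}` against `E`, at `p` and at `q`
  have h68 := fun (V V' : WeierstrassCurve ℚ) [V.IsElliptic] [V'.IsElliptic]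
      (hiso : V.IsIsogenous V') (r : ℕ) (hr : r.Prime) (hrN : r ∣ V.conductorNorm ℤ)
      (hr2 : ¬ r ^ 2 ∣ V.conductorNorm ℤ) =>
    lemma_6_8_factorization_form (PastenShimura2024_lemma_6_8_of_mazurKenku' hMK) V V' hiso r hr
      hrN hr2
  have h68_1p := h68 W W₁ hiso₁' p hp hpN' hp2N'
  have h68_1q := h68 W W₁ hiso₁' q hq hqN' hq2N'
  have h68_2p := h68 W W' hPm.1 p hp hpN' hp2N'
  have h68_2q := h68 W W' hPm.1 q hq hqN' hq2N'
  -- Lemma 6.14: `i_p(1,N), i_q(1,N) ∣ κ_S` (`N` squarefree away from `S`)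
  have hi_p : ip ∣ κ₁ := h614 W hadm.pos hWN hS hip heisp
  have hi_q : iq ∣ κ₁ := h614 W hadm.pos hWN hS hiq heisq
  -- Lemma 6.15 for `j_q(pq,M)`: against `r = q` (same prime: `j'_q ∣ c_q(A_{pq,M})`, Lemma 6.8) …
  have hjq_q : ∀ ℓ : ℕ, jq'.factorization ℓ ≤ cq.factorization ℓ + Nat.log ℓ 163 := fun ℓ => by
    obtain ⟨a, b, ha, ha', hb, hb', e⟩ := h68_2q
    exact factorization_le_of_dvd_of_mul_eq_mul (Dvd.intro_left _ hijq') ha ha' hb hb' hcqE e ℓ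
  have hjp_p : ∀ ℓ : ℕ, jp'.factorization ℓ ≤ cp.factorization ℓ + Nat.log ℓ 163 := fun ℓ => by
    obtain ⟨a, b, ha, ha', hb, hb', e⟩ := h68_2p
    exact factorization_le_of_dvd_of_mul_eq_mul (Dvd.intro_left _ hijp') ha ha' hb hb' hcpE e ℓ
  -- … and against `r = p` (switching primes between the two lines of Prop. 6.13)
  have hjq_p : ∀ ℓ : ℕ, jq'.factorization ℓ ≤ cp.factorization ℓ + α ℓ := fun ℓ => by
    have hsw := factorization_le_of_two_identities (K := κ₁.factorization ℓ) (ℓ := ℓ) hδ₁ hδ hiq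
      hip hjq' hjp' hcqE hcpE e613b e613a h68_1q h68_2q h68_1p h68_2p
      (factorization_le_of_dvd_of_ne_zero (by omega) hi_q ℓ)
    have := hjp_p ℓ
    show _ ≤ _ + (κ₁.factorization ℓ + 3 * Nat.log ℓ 163)
    omega
  have hjdvd : jq' ∣ Nat.gcd cp cq * K' :=
    dvd_gcd_mul_prod_pow_of_factorization_le hjq'.ne' hcpE.ne' hcqE.ne' (fun ℓ _ => hjq_p ℓ)
      (fun ℓ _ => (hjq_q ℓ).trans (by simp only [hαdef]; omega)) hα0
  -- §6.9: the identity with bounded `a`, `b`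
  obtain ⟨a₁, b₁, ha₁, ha₁', hb₁, hb₁', e₁⟩ := h68_1p
  obtain ⟨a₂, b₂, ha₂, ha₂', hb₂, hb₂', e₂⟩ := h68_2q
  set g := Nat.gcd cp cq
  have hile : ip ≤ κ₁ := Nat.le_of_dvd hκ₁ hi_p
  have hjle : jq' ≤ g * K' :=
    Nat.le_of_dvd (Nat.mul_pos (Nat.gcd_pos_of_pos_left _ hcpE) hK1) hjdvd
  refine ⟨a₁ * a₂, ip ^ 2 * jq' ^ 2 * (b₁ * b₂), Nat.mul_pos ha₁ ha₂,
    Nat.mul_pos (Nat.mul_pos (pow_pos hip 2) (pow_pos hjq' 2)) (Nat.mul_pos hb₁ hb₂), ?_, ?_, ?_⟩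
  · -- `a = a₁ a₂ ≤ 163²`
    rw [sq]
    exact Nat.mul_le_mul ha₁' ha₂'
  · -- `b = i² j² b₁ b₂ ≤ κ_S² (κ' gcd)² 163² = κ gcd²`
    calc ip ^ 2 * jq' ^ 2 * (b₁ * b₂) ≤ κ₁ ^ 2 * (g * K') ^ 2 * (163 * 163) :=
          Nat.mul_le_mul (Nat.mul_le_mul (Nat.pow_le_pow_left hile 2) (Nat.pow_le_pow_left hjle 2))
            (Nat.mul_le_mul hb₁' hb₂')
      _ = 163 ^ 2 * κ₁ ^ 2 * K' ^ 2 * g ^ 2 := by ring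
  · -- the identity `δ_{1,N} b = a δ_{pq,M} c_p(E) c_q(E)`
    calc δ₁ * (ip ^ 2 * jq' ^ 2 * (b₁ * b₂))
        = δ₁ * (ip ^ 2 * jq' ^ 2) * (b₁ * b₂) := by ring
      _ = δ * (c₁p * c'q) * (b₁ * b₂) := by rw [e613a]
      _ = δ * ((c₁p * b₁) * (c'q * b₂)) := by ring
      _ = δ * ((a₁ * cp) * (a₂ * cq)) := by rw [e₁, e₂]
      _ = a₁ * a₂ * δ * (cp * cq) := by ring

end Core

/-! ## §E. The two-prime package from the dictionary, Mazur's theorems and the small primes of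
Lemma 6.7 -/

section Final

variable
  (hDict : ∀ (W : WeierstrassCurve ℚ) [W.IsElliptic] (M r : ℕ) [NeZero (M * r)],
    r.Prime → M.Coprime r → W.conductorNorm ℤ = M * r →
    ∀ P : ModularParametrizationData W (M * r),
      (∀ (W' : WeierstrassCurve ℚ) [W'.IsElliptic], W'.conductorNorm ℤ = M * r →
          ∀ P' : ModularParametrizationData W' (M * r),
          P'.f = P.f → P.modularDegree ≤ P'.modularDegree) →
      ∀ (S : Brandt.XiSetup M r) [Fintype (Brandt.ClassSet S.O)],
        ∃ (X : Submodule ℤ (Brandt.ClassSet S.O → ℤ)) (pb : ℤ →ₗ[ℤ] X) (pf : X →ₗ[ℤ] ℤ),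
          (∀ (a : ℤ) (y : X),
              ∑ i, (Brandt.weight S.O i : ℤ) * (pb a : Brandt.ClassSet S.O → ℤ) i *
                  (y : Brandt.ClassSet S.O → ℤ) i =
                ((W.minimalDiscriminantNorm ℤ).factorization r : ℤ) * a * pf y) ∧
          (∀ a : ℤ, pf (pb a) = (P.modularDegree : ℤ) * a) ∧
          Function.Surjective pf ∧
          (∀ (m : ℤ) (v : Brandt.ClassSet S.O → ℤ), m ≠ 0 → m • v ∈ X → v ∈ X) ∧
          (∀ v : Brandt.ClassSet S.O → ℤ, ∑ i, v i = 0 → v ∈ X) ∧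
          Module.finrank ℤ
              (Brandt.eigenLattice (M * r) (Brandt.matrix S.O) (fun n => W.LFunction n)) = 1 ∧
          (pb 1 : Brandt.ClassSet S.O → ℤ) ∈
            Brandt.eigenLattice (M * r) (Brandt.matrix S.O) (fun n => W.LFunction n))
  (hT2 : ∀ {N D M p d : ℕ}, p.Prime → D = p * d → IsAdmissibleFactorization N D M →
    ∀ (X : ShimuraCurveData D M) (W : WeierstrassCurve ℚ) [W.IsElliptic],
      W.conductorNorm ℤ = N →
    ∀ (W' : WeierstrassCurve ℚ) [W'.IsElliptic] (P : ShimuraParametrizationData X W'),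
      P.IsMinimalFor W →
    ∀ S : Brandt.XiSetup (p * M) d,
      ∃ i j : ℕ, 0 < i ∧ i * j = (W'.minimalDiscriminantNorm ℤ).factorization p ∧
        i ∣ S.xi (fun n => W'.LFunction n) ∧
        P.deg * i = S.xi (fun n => W'.LFunction n) * j)
  /- (`h67small`) Pasten's Lemma 6.7 at the primes `ℓ ≤ 163` only (Lemmas 6.4–6.6: Faltings on the
  modular curves `Y_H`, Shafarevich), weak form: one good prime `r ∤ N_A` with
  `ℓ^{β_S(ℓ)} ∤ r + 1 − a_r(A)` for every `A/ℚ` semi-stable away from `S`. -/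
  (h67small : ∀ (S : Finset ℕ) (ℓ : ℕ), ℓ.Prime → ℓ ≤ 163 → ∃ β : ℕ,
    ∀ (A : WeierstrassCurve ℚ) [A.IsElliptic],
      (∀ q : ℕ, q.Prime → q ∉ S → ¬ q ^ 2 ∣ A.conductorNorm ℤ) →
      ∃ r : ℕ, r.Prime ∧ ¬ r ∣ A.conductorNorm ℤ ∧
        ¬ ((ℓ ^ β : ℕ) : ℤ) ∣ (r + 1 : ℤ) - A.LFunction r)

include hDict hT2 h67small in
/-- **Pasten 2024, the pairwise `gcd`-bounded denominator of `γ_{pq,M,E}`, from the `D = 1`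
character-group dictionary, Takahashi's Shimura-side formula, Mazur's two theorems and the small
primes of Lemma 6.7 — level input explicit.** No Eisenstein hypothesis: Ribet's Thm. 3.12 is
replaced by `exists_image_coker_eisenstein_of_brandtData` (§A–§B), and Lemma 6.7 above `163` by
`mazur_isogeny_irreducible` with Chebotarev (§C). [cite: PastenShimura2024, §6.9 (EqSequentially) p. 25 with d = 1, Lemma 6.14 p. 23, Lemma 6.3 p. 21] [cite: Mazur1978, Thm. 1] -/
theorem PastenShimura2024_pairwise_denominator_of_brandtDictionary_of_level
    (hMaz : mazur_isogeny_irreducible) (hMK : mazurKenku_exists_cyclic_isogeny)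
    (hlev : ∀ {N : ℕ} [NeZero N] {W₁ : WeierstrassCurve ℚ} [W₁.IsElliptic]
      (D₁ : ModularParametrizationData W₁ N) (W : WeierstrassCurve ℚ) [W.IsElliptic],
      IsNewformOf W D₁.f → W.conductorNorm ℤ = N → W₁.conductorNorm ℤ = N) :
    PastenShimura2024_pairwise_denominator :=
  PastenShimura2024_pairwise_denominator_of_imageCokernel_package hT2 12 hMK
    (fun {_} _ W _ {_ _} hN hr hMr hW P hmin S =>
      imageCokernel_package_of_brandtDictionary hDict W hN hr hMr hW P hmin S)
    (fun S => exists_dvd_of_eisenstein12_of_mazur hMaz (h67small S)) hlev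

include hDict hT2 h67small in
/-- **The same, level input from Carayol's theorem** (`IsNewformOf.level_eq_conductorNorm`, tree
fact — a theorem of the tree granted modularity). [cite: PastenShimura2024, §6.9 (EqSequentially) p. 25 with d = 1] [cite: Carayol1986] -/
theorem PastenShimura2024_pairwise_denominator_of_brandtDictionary_of_carayol
    (hMaz : mazur_isogeny_irreducible) (hMK : mazurKenku_exists_cyclic_isogeny)
    (hCar : ∀ {N : ℕ} [NeZero N], IsNewformOf.level_eq_conductorNorm (N := N)) :
    PastenShimura2024_pairwise_denominator :=
  PastenShimura2024_pairwise_denominator_of_brandtDictionary_of_level hDict hT2 h67small hMaz hMK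
    fun D₁ _ _ _ _ => (hCar D₁.isNewformOf).symm

include hDict hT2 h67small in
/-- **The same, level input from Ogg–Saito** (the conductor is an isogeny invariant granted the
tree's schema `artinConductorExponent_tate_eq_conductorExponent_of_isElliptic`,
`conductorNorm_eq_of_isIsogenous_of_tate`; `W₁ ∼ W` by Faltings). So, over the tree,
`PastenShimura2024_pairwise_denominator` follows from: the named facts `mazur_isogeny_irreducible`,
`mazurKenku_exists_cyclic_isogeny`, the Ogg–Saito schema; the `D = 1` character-group dictionary
`hDict` (shape of `takahashi2001_characterGroupDictionary` ∧ `takahashi2001_brandtEigenLattice_rank_one`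
at `r ∥ N`, degree-zero clause recorded); `hT2` (Takahashi 2001, Thm. 2.3 at `p ∣ D` with Thm. 3.2 (a));
and the small primes of Pasten's Lemma 6.7. [cite: PastenShimura2024, §6.9 (EqSequentially) p. 25 with d = 1] [cite: SilvermanATAEC1994, Exercise 4.40 with §IV.10] -/
theorem PastenShimura2024_pairwise_denominator_of_brandtDictionary_of_oggSaito
    (hMaz : mazur_isogeny_irreducible) (hMK : mazurKenku_exists_cyclic_isogeny)
    (hOS : ∀ (W : WeierstrassCurve ℚ) (ℓ : ℕ) [Fact ℓ.Prime],
      W.artinConductorExponent_tate_eq_conductorExponent_of_isElliptic ℓ) :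
    PastenShimura2024_pairwise_denominator :=
  PastenShimura2024_pairwise_denominator_of_brandtDictionary_of_level hDict hT2 h67small hMaz hMK
    fun D₁ W _ hf hWN => by
      have hiso := isIsogenous_of_lFunction_prime_eq_of_not_dvd (N₀ := 1) one_ne_zero
        fun ℓ _ _ => by
          have h := (D₁.isNewformOf.2 ℓ).symm.trans (hf.2 ℓ)
          exact_mod_cast h
      exact (conductorNorm_eq_of_isIsogenous_of_tate hOS _ _ hiso).trans hWN

include hDict hT2 in
/-- **The same with Pasten's Lemma 6.7 verbatim** (the `h67` of the sibling files, all primes,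
infinitely many `r`) in place of `h67small` — only its primes `ℓ ≤ 163` are used
(`small_lemma_6_7_of_lemma_6_7`); level input from Ogg–Saito. [cite: PastenShimura2024, Lemma 6.7 p. 22, §6.9 p. 25] -/
theorem PastenShimura2024_pairwise_denominator_of_brandtDictionary_of_lemma_6_7_of_oggSaito
    (h67 : ∀ (S : Finset ℕ) (ℓ : ℕ), ℓ.Prime → ∃ β : ℕ, (163 < ℓ → β = 1) ∧
      ∀ (A : WeierstrassCurve ℚ) [A.IsElliptic],
        (∀ q : ℕ, q.Prime → q ∉ S → ¬ q ^ 2 ∣ A.conductorNorm ℤ) →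
        ∀ r₀ : ℕ, ∃ r : ℕ, r₀ < r ∧ r.Prime ∧ ¬ ((ℓ ^ β : ℕ) : ℤ) ∣ (r + 1 : ℤ) - A.LFunction r)
    (hMaz : mazur_isogeny_irreducible) (hMK : mazurKenku_exists_cyclic_isogeny)
    (hOS : ∀ (W : WeierstrassCurve ℚ) (ℓ : ℕ) [Fact ℓ.Prime],
      W.artinConductorExponent_tate_eq_conductorExponent_of_isElliptic ℓ) :
    PastenShimura2024_pairwise_denominator :=
  PastenShimura2024_pairwise_denominator_of_brandtDictionary_of_oggSaito hDict hT2
    (fun S ℓ hℓ h163 => small_lemma_6_7_of_lemma_6_7 (h67 S) ℓ hℓ h163) hMaz hMK hOS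

end Final

end Literature.NumberTheory.Automorphic

end
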